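import Summits.AnomalousDissipation.AnomalousDissipation.Theorems.BaireTransferDenseLoudDesignerForcesErgodicLine
import Literature.Analysis.FunctionSpaces.TorusClassicalNSUniqueness
import Literature.Analysis.FunctionSpaces.TorusClassicalNSRestart
import Literature.Analysis.FluidPDE.PeriodicBoundedMildTorus
import HarnessLib

/-!
# Stub `stub_eternalOrbit` of the line `SketchIdeator2` (card `separatrix-flux-pinning`)
# (crux `MarginalStabilityChain.ChainRealisation`, stmt-AnomalousDissipation-14249)

Sorry-free discharge of the registered stub `stub_eternalOrbit` (E1b) of the lead's skeleton
(`Cruxes/ChainRealisation/Lines/SketchIdeator2.lean`): **a point of an NS phase with a complete backward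
chain lies on an ETERNAL classical Navier–Stokes solution.**  Let `(K, φ)` be an NS phase of viscosity
`ν ≥ 0` forced by the steady field `F` (`IsNSPhase`: `K` compact, `φ` a semiflow on `K`, jointly
continuous on `Ici 0 × K`, every point of `K` carrying a classical trajectory on `[0, ∞) × T³` which
represents its phase orbit), and let `y ∈ K` have `φₙ`-preimages in `K` at every integer depth `n`.  Then
there is a classical solution `(v, q)` of the same system on ALL of `ℝ × T³` whose forward part represents
the phase orbit of `y`.

**Proof.**
* COHERENT BACKWARD ORBIT (`stub_eternalOrbit_aux_backward_orbit`).  The set of points of `K` with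
  preimages at every depth is mapped onto itself by `φ₁`: if `w = φ_{n+1} aₙ`, `aₙ ∈ K`, put
  `zₙ = φₙ aₙ ∈ K`; then `φ₁ zₙ = w`, `zₙ ∈ φₘ(K)` for `m ≤ n` (the images decrease), a cluster point
  `z ∈ K` of `(zₙ)` (compactness) has `φ₁ z = w` (continuity of `φ₁` on `K`) and lies in every `φₘ(K)`
  (closed).  Iterating gives `Y : ℕ → K`, `Y 0 = y`, `φ₁ (Y (k+1)) = Y k`.
* CONSISTENCY.  The classical trajectories `(u k, p k)` of the `Y k` (`IsNSPhase.trajectory`) satisfy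
  `u (k+1) 1 = u k 0` (both represent `Y k = φ₁ (Y (k+1)) = φ₀ (Y k)` a.e., and continuous fields that
  agree a.e. on `T³` agree), so the time shifts `U k = u k (· + k)`, classical on `[-k, ∞)`
  (`Torus.IsClassicalNSSolutionOn.comp_add_const`), agree at `t = -k` and hence on `[-k, ∞)` by forward
  uniqueness of classical solutions (`Torus.IsClassicalNSSolutionOn.velocity_unique_of_mem`, the energy
  method, Majda–Bertozzi 2002 Cor. 3.1); the pressures, normalised at a base point, then agree on
  `(-k, ∞)` (`Torus.IsClassicalNSSolutionOn.pressure_sub_eq_of_eventuallyEq`).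
* GLUING (`stub_eternalOrbit_aux_glue`).  `v t = U (N t) t`, `q t = P (N t) t` with `N t = ⌈-t⌉₊ + 1`;
  being a classical solution is local in time on the open time set `univ`
  (`Torus.IsClassicalNSSolutionOn.of_local`), and near every `t` the pair `(v, q)` is `(U k, P k)` for a
  suitable `k`.  For `t ≥ 0`, `v t = u 0 t` represents `φ_t y`.

References: A. J. Majda, A. L. Bertozzi, *Vorticity and Incompressible Flow* (CUP 2002), Cor. 3.1;
J. C. Robinson, J. L. Rodrigo, W. Sadowski, *The Three-Dimensional Navier–Stokes Equations* (CUP 2016),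
§6.3 and §8.1 (restart and identification on the overlap); C. Foias, O. Manley, R. Rosa, R. Temam,
*Navier–Stokes Equations and Turbulence* (CUP 2001), Ch. IV (invariant sets of the semiflow).
-/

set_option linter.dupNamespace false

noncomputable section

open MeasureTheory Set Filter Topology
open scoped InnerProductSpace
open Literature.Analysis.FunctionSpaces Literature.Analysis.FunctionSpaces.Torus
open Literature.Analysis.FluidPDE

namespace Summit.AnomalousDissipation.AnomalousDissipation.Theorems.ChainRealisation.SeparatrixFluxPinning

open Summit.AnomalousDissipation.AnomalousDissipation.Theorems.DenseLoudDesignerForces.Ergodic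
open Literature.Analysis.FluidPDE.Torus

/-- Local notation: the torus `T³`. -/
local notation "𝕋³" => UnitAddTorus (Fin 3)
/-- Local notation: velocity values. -/
local notation "E³" => EuclideanSpace ℝ (Fin 3)

variable {ν : ℝ} {F : 𝕋³ → E³} {K : Set Hsp} {φ : ℝ → Hsp → Hsp}

/-! ## The coherent backward orbit -/

/-- The images `φ_t(K)` (`t ≥ 0`) are closed: `φ_t` is continuous on `K` (joint continuity composed
with `x ↦ (t, x)`; cf. `stub_genericLoudPoint_aux_continuousOn` of the sibling stub), so `φ_t(K)` is a
compact image of the compact `K`. -/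
theorem stub_eternalOrbit_aux_isClosed_image (hK : IsNSPhase ν F K φ) {t : ℝ} (ht : 0 ≤ t) :
    IsClosed (φ t '' K) :=
  (hK.isCompact.image_of_continuousOn (hK.continuousOn.comp
    (Continuous.prodMk_right t).continuousOn fun _ hx => ⟨mem_Ici.2 ht, hx⟩)).isClosed

/-- The images decrease along the semiflow: `φ_{s+t}(K) ⊆ φ_s(K)` for `s, t ≥ 0`. -/
theorem stub_eternalOrbit_aux_image_add_subset (hK : IsNSPhase ν F K φ) {s t : ℝ} (hs : 0 ≤ s)
    (ht : 0 ≤ t) : φ (s + t) '' K ⊆ φ s '' K := by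
  rintro _ ⟨z, hz, rfl⟩
  exact ⟨φ t z, hK.mapsTo t ht hz, (hK.map_add s t hs ht z hz).symm⟩

/-- **Backward step inside `⋂ₙ φₙ(K)`.** If `w` has `φₙ`-preimages in `K` at every integer depth, then
`w = φ₁ z` for some `z ∈ K` which again has preimages in `K` at every depth (compactness of `K`,
continuity of `φ₁` on `K`, closedness of the decreasing images `φₘ(K)`). -/
theorem stub_eternalOrbit_aux_backward_step (hK : IsNSPhase ν F K φ) {w : Hsp}
    (hw : ∀ n : ℕ, ∃ a ∈ K, φ n a = w) :
    ∃ z ∈ K, (∀ n : ℕ, ∃ a ∈ K, φ n a = z) ∧ φ 1 z = w := by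
  choose a ha haw using fun n : ℕ => hw (n + 1)
  set zs : ℕ → Hsp := fun n => φ n (a n) with hzs_def
  have hzK : ∀ n, zs n ∈ K := fun n => hK.mapsTo n (Nat.cast_nonneg n) (ha n)
  have hz1 : ∀ n, φ 1 (zs n) = w := fun n => by
    have h := hK.map_add 1 n zero_le_one (Nat.cast_nonneg n) (a n) (ha n)
    have hc : ((n + 1 : ℕ) : ℝ) = 1 + n := by push_cast; ring
    rw [← h, ← hc]
    exact haw n
  have hzm : ∀ m n : ℕ, m ≤ n → zs n ∈ φ m '' K := by
    intro m n hmn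
    obtain ⟨j, rfl⟩ := Nat.exists_eq_add_of_le hmn
    have hc : ((m + j : ℕ) : ℝ) = (m : ℝ) + j := by push_cast; ring
    have hsub := stub_eternalOrbit_aux_image_add_subset hK (Nat.cast_nonneg m) (Nat.cast_nonneg j)
    rw [← hc] at hsub
    exact hsub ⟨a (m + j), ha _, rfl⟩
  obtain ⟨z, hzK', ψ, hψ, hlim⟩ := hK.isCompact.tendsto_subseq hzK
  refine ⟨z, hzK', fun m => ?_, ?_⟩
  · have hmem : z ∈ φ m '' K := by
      refine (stub_eternalOrbit_aux_isClosed_image hK (Nat.cast_nonneg m)).mem_of_tendsto hlim ?_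
      filter_upwards [eventually_ge_atTop m] with n hn
      exact hzm m (ψ n) (hn.trans hψ.le_apply)
    obtain ⟨a', ha', h'⟩ := hmem
    exact ⟨a', ha', h'⟩
  · have hcont : ContinuousWithinAt (φ 1) K z :=
      (hK.continuousOn.comp (Continuous.prodMk_right (1 : ℝ)).continuousOn
        fun _ hx => ⟨mem_Ici.2 zero_le_one, hx⟩) z hzK'
    have hlimK : Tendsto (zs ∘ ψ) atTop (𝓝[K] z) :=
      tendsto_nhdsWithin_iff.2 ⟨hlim, Eventually.of_forall fun n => hzK _⟩
    have h1 : Tendsto (φ 1 ∘ (zs ∘ ψ)) atTop (𝓝 (φ 1 z)) := hcont.tendsto.comp hlimK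
    have h2 : (φ 1 ∘ (zs ∘ ψ)) = fun _ => w := funext fun n => hz1 _
    rw [h2] at h1
    exact (tendsto_const_nhds_iff.1 h1).symm

/-- **Coherent backward orbit.** A point `y ∈ K` with `φₙ`-preimages in `K` at every integer depth lies
on a backward orbit of `φ₁` in `K`: there is `Y : ℕ → H` with `Y 0 = y`, `Y k ∈ K` and
`φ₁ (Y (k+1)) = Y k` (iterate the backward step on the set of points with complete chains). -/
theorem stub_eternalOrbit_aux_backward_orbit (hK : IsNSPhase ν F K φ) {y : Hsp} (hy : y ∈ K)
    (hchain : ∀ n : ℕ, ∃ z ∈ K, φ n z = y) :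
    ∃ Y : ℕ → Hsp, Y 0 = y ∧ (∀ k, Y k ∈ K) ∧ ∀ k, φ 1 (Y (k + 1)) = Y k := by
  have hstep : ∀ w : {w : Hsp // w ∈ K ∧ ∀ n : ℕ, ∃ a ∈ K, φ n a = w},
      ∃ z : {w : Hsp // w ∈ K ∧ ∀ n : ℕ, ∃ a ∈ K, φ n a = w}, φ 1 z.1 = w.1 := by
    rintro ⟨w, hwK, hw⟩
    obtain ⟨z, hzK, hz, hz1⟩ := stub_eternalOrbit_aux_backward_step hK hw
    exact ⟨⟨z, hzK, hz⟩, hz1⟩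
  choose g hg using hstep
  refine ⟨fun k => (g^[k] ⟨y, hy, hchain⟩).1, rfl, fun k => (g^[k] ⟨y, hy, hchain⟩).2.1,
    fun k => ?_⟩
  show φ 1 (g^[k + 1] ⟨y, hy, hchain⟩).1 = (g^[k] ⟨y, hy, hchain⟩).1
  rw [Function.iterate_succ_apply']
  exact hg _

/-! ## Gluing a consistent chain of forward classical solutions into an eternal one -/

/-- **Gluing.** Let `(u k, p k)`, `k : ℕ`, be classical solutions of the Navier–Stokes system with
viscosity `ν ≥ 0` and steady force `F` on `[0, ∞) × T³` such that `u (k+1) 1 = u k 0`.  Then there is a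
classical solution `(v, q)` on `ℝ × T³` with `v t = u 0 t` for `t ≥ 0`: the time shifts
`U k = u k (· + k)` are classical on `[-k, ∞)` (autonomy), agree at `t = -k`, hence on `[-k, ∞)`
(forward uniqueness, Majda–Bertozzi 2002, Cor. 3.1), their pressures normalised at the base point `0`
agree on `(-k, ∞)`, and the resulting consistent family is a classical solution on the open time set
`univ` by locality in time (Robinson–Rodrigo–Sadowski 2016, §8.1). -/
theorem stub_eternalOrbit_aux_glue (hν : 0 ≤ ν) {u : ℕ → ℝ → 𝕋³ → E³} {p : ℕ → ℝ → 𝕋³ → ℝ}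
    (hsol : ∀ k, IsClassicalNSSolutionOn (Ici 0) ν (fun _ => F) (u k) (p k))
    (hdata : ∀ k, u (k + 1) 1 = u k 0) :
    ∃ (v : ℝ → 𝕋³ → E³) (q : ℝ → 𝕋³ → ℝ),
      IsClassicalNSSolutionOn Set.univ ν (fun _ => F) v q ∧ ∀ t : ℝ, 0 ≤ t → v t = u 0 t := by
  -- the shifted solutions and their normalised pressures
  set x₀ : 𝕋³ := 0 with hx₀_def
  set U : ℕ → ℝ → 𝕋³ → E³ := fun k t => u k (t + k) with hU_def
  set P : ℕ → ℝ → 𝕋³ → ℝ := fun k t x => p k (t + k) x - p k (t + k) x₀ with hP_def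
  have hsub : ∀ k : ℕ, Ici (-(k : ℝ)) ⊆ (· + (k : ℝ)) ⁻¹' Ici 0 := fun k s hs => by
    simp only [mem_preimage, mem_Ici] at hs ⊢
    linarith
  have hU' : ∀ k : ℕ,
      IsClassicalNSSolutionOn (Ici (-(k : ℝ))) ν (fun _ => F) (U k) (fun t => p k (t + k)) :=
    fun k => ((hsol k).comp_add_const (k : ℝ)).mono (hsub k) (uniqueDiffOn_Ici _)
  have hU : ∀ k : ℕ, IsClassicalNSSolutionOn (Ici (-(k : ℝ))) ν (fun _ => F) (U k) (P k) :=
    fun k => (hU' k).sub_pressure_apply x₀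
  -- consistency of the velocities: one step, by forward uniqueness from the anchor `-k`
  have hcons : ∀ (k : ℕ) (t : ℝ), -(k : ℝ) ≤ t → U (k + 1) t = U k t := by
    intro k t ht
    have hk1 : Ici (-(k : ℝ)) ⊆ Ici (-((k + 1 : ℕ) : ℝ)) := Ici_subset_Ici.2 (by push_cast; linarith)
    have h₁ := (hU (k + 1)).mono hk1 (uniqueDiffOn_Ici _)
    have h0 : U (k + 1) (-(k : ℝ)) = U k (-(k : ℝ)) := by
      have e₁ : U (k + 1) (-(k : ℝ)) = u (k + 1) 1 := by
        simp only [hU_def]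
        congr 1
        push_cast
        ring
      have e₂ : U k (-(k : ℝ)) = u k 0 := by
        simp only [hU_def]
        congr 1
        ring
      rw [e₁, e₂, hdata k]
    exact h₁.velocity_unique_of_mem hν (convex_Ici _) (hU k) (t₀ := -(k : ℝ)) self_mem_Ici h0
      (mem_Ici.2 ht) ht
  -- consistency of the velocities: all steps
  have hconsm : ∀ (k m : ℕ) (t : ℝ), k ≤ m → -(k : ℝ) ≤ t → U m t = U k t := by
    intro k m t hkm ht
    obtain ⟨j, rfl⟩ := Nat.exists_eq_add_of_le hkm
    induction j with
    | zero => rfl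
    | succ j ih =>
        have hkj : -((k + j : ℕ) : ℝ) ≤ t := by push_cast; linarith
        exact (hcons (k + j) t hkj).trans (ih (Nat.le_add_right k j))
  -- consistency of the normalised pressures on the open overlaps
  have hPcons : ∀ (k : ℕ) (t : ℝ), -(k : ℝ) < t → P (k + 1) t = P k t := by
    intro k t ht
    have ht₁ : Ici (-((k + 1 : ℕ) : ℝ)) ∈ 𝓝 t := Ici_mem_nhds (by push_cast; linarith)
    have ht₂ : Ici (-(k : ℝ)) ∈ 𝓝 t := Ici_mem_nhds ht
    have heq : ∀ᶠ τ in 𝓝 t, U (k + 1) τ = U k τ := by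
      filter_upwards [Ioi_mem_nhds ht] with τ hτ using hcons k τ (le_of_lt hτ)
    funext x
    exact (hU' (k + 1)).pressure_sub_eq_of_eventuallyEq (hU' k) ht₁ ht₂ heq x x₀
  have hPconsm : ∀ (k m : ℕ) (t : ℝ), k ≤ m → -(k : ℝ) < t → P m t = P k t := by
    intro k m t hkm ht
    obtain ⟨j, rfl⟩ := Nat.exists_eq_add_of_le hkm
    induction j with
    | zero => rfl
    | succ j ih =>
        have hkj : -((k + j : ℕ) : ℝ) < t := by push_cast; linarith
        exact (hPcons (k + j) t hkj).trans (ih (Nat.le_add_right k j))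
  -- the gluing index `N t = ⌈-t⌉₊ + 1`, with `-N t < t`
  set N : ℝ → ℕ := fun t => ⌈-t⌉₊ + 1 with hN_def
  have hN : ∀ t : ℝ, -((N t : ℕ) : ℝ) < t := fun t => by
    have h := Nat.le_ceil (-t)
    simp only [hN_def]
    push_cast
    linarith
  refine ⟨fun t => U (N t) t, fun t => P (N t) t, ?_, fun t ht => ?_⟩
  · -- classical on `univ`, by locality in time
    refine Literature.Analysis.FunctionSpaces.Torus.IsClassicalNSSolutionOn.of_local isOpen_univ
      fun t _ => ⟨Ioi (-((N t : ℕ) : ℝ)), isOpen_Ioi, hN t, subset_univ _, U (N t), P (N t),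
        (hU (N t)).mono Ioi_subset_Ici_self isOpen_Ioi.uniqueDiffOn, fun s hs => ?_, fun s hs => ?_⟩
    · have hs' : -((N t : ℕ) : ℝ) < s := hs
      exact (hconsm (N t) (max (N t) (N s)) s (le_max_left _ _) hs'.le).symm.trans
        (hconsm (N s) (max (N t) (N s)) s (le_max_right _ _) (hN s).le)
    · have hs' : -((N t : ℕ) : ℝ) < s := hs
      exact (hPconsm (N t) (max (N t) (N s)) s (le_max_left _ _) hs').symm.trans
        (hPconsm (N s) (max (N t) (N s)) s (le_max_right _ _) (hN s))
  · -- the forward part is `u 0`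
    have h0 : -((0 : ℕ) : ℝ) ≤ t := by push_cast; linarith
    change U (N t) t = u 0 t
    rw [hconsm 0 (N t) t (Nat.zero_le _) h0]
    simp [hU_def]

/-! ## The stub -/

/-- Stub E1b (M–L) **ETERNAL ORBIT**: a point of an NS phase with a complete backward chain in `K` lies
on an ETERNAL classical solution of the same system (compactness of `K` + continuity of `φ₁` turn the
chain into a coherent backward orbit inside `⋂ₙ φₙ(K)`; the classical trajectories of its points
(`IsNSPhase.trajectory`) agree on overlaps by `Torus.IsClassicalNSSolutionOn.velocity_unique_of_mem`
after time translation, and glue — with the pressures normalised at a base point — to a classical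
solution on `ℝ × T³`). -/
theorem stub_eternalOrbit :
    ∀ (ν : ℝ) (F : 𝕋³ → E³) (K : Set Hsp) (φ : ℝ → Hsp → Hsp) (y : Hsp),
      0 ≤ ν → IsNSPhase ν F K φ → y ∈ K → (∀ n : ℕ, ∃ z ∈ K, φ n z = y) →
      ∃ (v : ℝ → 𝕋³ → E³) (q : ℝ → 𝕋³ → ℝ),
        IsClassicalNSSolutionOn Set.univ ν (fun _ => F) v q ∧
        ∀ t : ℝ, 0 ≤ t → rep (φ t y) =ᵐ[volume] v t := by
  intro ν F K φ y hν hK hy hchain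
  obtain ⟨Y, hY0, hYK, hY1⟩ := stub_eternalOrbit_aux_backward_orbit hK hy hchain
  choose u p hsol hrep using fun k => hK.trajectory (Y k) (hYK k)
  -- equal data: `u (k+1) 1 = u k 0` (both represent `Y k` a.e.; continuous fields agreeing a.e. agree)
  have hdata : ∀ k, u (k + 1) 1 = u k 0 := by
    intro k
    have h₁ : rep (Y k) =ᵐ[volume] u (k + 1) 1 := by
      have h := hrep (k + 1) 1 zero_le_one
      rwa [hY1 k] at h
    have h₀ : rep (Y k) =ᵐ[volume] u k 0 := by
      have h := hrep k 0 le_rfl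
      rwa [hK.map_zero (Y k) (hYK k)] at h
    have hc₁ : Continuous (u (k + 1) 1) :=
      ((hsol (k + 1)).smooth_velocity.isSmooth_slice (mem_Ici.2 zero_le_one)).continuous
    have hc₀ : Continuous (u k 0) :=
      ((hsol k).smooth_velocity.isSmooth_slice (mem_Ici.2 le_rfl)).continuous
    exact Measure.eq_of_ae_eq (h₁.symm.trans h₀) hc₁ hc₀
  obtain ⟨v, q, hv, hv0⟩ := stub_eternalOrbit_aux_glue hν hsol hdata
  refine ⟨v, q, hv, fun t ht => ?_⟩
  rw [hv0 t ht, ← hY0]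
  exact hrep 0 t ht

end Summit.AnomalousDissipation.AnomalousDissipation.Theorems.ChainRealisation.SeparatrixFluxPinning

end
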